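import Summits.SmoothPoincare4.SmoothPoincare4.Theorems.ConvexBisectionAcyclicBisectionExistsBoundaryCircles
import Summits.SmoothPoincare4.SmoothPoincare4.Theorems.ConvexBisectionAcyclicBisectionExistsKasSphereOffCore
import HarnessLib

/-!
# The boundary of a multi-attachment of 2-handles is connected (T3 clause (v), CONNECTED — part 2)
(helper for stub `stub_T3_dualPresentation` = T3, extras ▸ clause (v) `ConnectedSpace b₁.carrier`
for the prefix piece `X₁`; line `modp-braid-orbits` r12, crux `ConvexBisection.AcyclicBisectionExists`,
item stmt-SmoothPoincare4-10508; wave 5 / worker X6, lead c5; Y7-REPORT §2 row (v).)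

For `X` a simultaneous Kosinski attachment of 2-handles on a 4-manifold `B` with CONNECTED boundary
(`MultiAttachmentData h (𝓡∂ 4) X`), every boundary datum `bX` of `X` has connected carrier
(Gompf–Stipsicz 1999, §8.2: `∂X` is the surgery on `∂B` along the framed attaching link):

* §1 `connectedSpace_carrier_of_multiAttachmentData` — the seam `bX.carrier ≅ ∂X` is covered by
  `U = incl⁻¹(range jA) ≅ ∂B ∖ ⋃ Kᵢ` (preconnected and nonempty by part 1,
  `…BoundaryCircles.lean`: `isPreconnected_boundary_off_cores`, transported along the embeddings
  `incl`, `jA`, `Subtype.val`) and the open solid tori `Wᵢ = incl⁻¹(range jBᵢ) ≅ S³ ∖ S`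
  (`isPathConnected_sphereOffCore`), the `i`-th torus meeting `U` at the glued Clifford point
  `jA (h̄ᵢ c) = jBᵢ (α c)`, `c = (θ₀, θ₀)/√2`; a union of preconnected sets through common points
  (`isPreconnected_of_forall`);
* §2 the exported forms `connectedSpace_boundary_of_multiAttachmentData` (general `B`, data form),
  `connectedSpace_boundary_of_isMultiAttachment` (relational form),
  `connectedSpace_boundary_of_multiAttachmentData_base` (`B = Base g`, by
  `isConnected_boundary_base`) and the registered sub-goal `helper_T3_connected` (any finite
  multi-attachment of 2-handles on `Base g`, any boundary datum — in particular T3's `b₁` for the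
  prefix family and `X₁` of `exists_compatible_split`).

Everything is proved; no definitions, no named facts, no `sorry`.  References: A. A. Kosinski,
*Differential Manifolds* (1993), VI §6 [Kosinski1993]; R. E. Gompf, A. I. Stipsicz, *4-Manifolds and
Kirby Calculus* (1999), §8.2 [GompfStipsicz1999].
-/

noncomputable section

-- the prescribed namespace `Summit.<P>.<Sub>.…` duplicates `SmoothPoincare4` (P = Sub)
set_option linter.dupNamespace false

open scoped Manifold ContDiff Topology
open Set Function Filter Metric
open Literature.Topology.FourManifolds Literature.Topology.FourManifolds.LefschetzBase
  Literature.Topology.FourManifolds.HandleAttachingMap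

namespace Summit.SmoothPoincare4.SmoothPoincare4.Theorems.AcyclicBisectionExists.ModpBraidOrbits

namespace BoundaryConnected

/-! ## §1 The seam of a multi-attachment -/

section Attachment

variable {B : Type*} [TopologicalSpace B] [T2Space B] [ChartedSpace (EuclideanHalfSpace 4) B]
  {ι : Type*} [Finite ι] {h : ι → HandleAttachingMap 3 2 B}
  {X : Type*} [TopologicalSpace X] [ChartedSpace (EuclideanHalfSpace 4) X]
  (D : MultiAttachmentData h (𝓡∂ 4) X) (bX : BoundaryData (𝓡∂ 4) X (𝓡 3))

/-- `jBᵢ b ∈ ∂X ↔ b ∈ S³ ∖ S` (`∂𝔻⁴ = S³`). [cite: Kosinski1993, VI §6] -/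
theorem jB_mem_boundary_iff (i : ι) (b : ↥(beltPiece 3 2)) :
    D.jB i b ∈ (𝓡∂ 4).boundary X ↔ b ∈ sphereOffCore := by
  rw [mem_boundary_iff_of_isSmoothEmbedding (D.hjB i).1 (D.hjB i).2,
    mem_boundary_opens_iff (beltPiece 3 2) b]
  change (b : closedBall (0 : EuclideanSpace ℝ (Fin 4)) 1) ∈ (𝓡∂ (3 + 1)).boundary
    (closedBall (0 : EuclideanSpace ℝ (Fin (3 + 1))) 1) ↔ _
  rw [boundary_closedBall]
  rfl

/-- **The handle pieces of the seam**, read in `X`: `incl (incl⁻¹ (range jBᵢ)) = jBᵢ (S³ ∖ S)`.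
[cite: GompfStipsicz1999, §8.2] -/
theorem image_incl_preimage_range_jB (i : ι) :
    bX.incl '' (bX.incl ⁻¹' range (D.jB i)) = D.jB i '' sphereOffCore := by
  rw [image_preimage_eq_range_inter, bX.range_incl]
  ext p
  constructor
  · rintro ⟨hp, b, rfl⟩
    exact ⟨b, (jB_mem_boundary_iff D i b).1 hp, rfl⟩
  · rintro ⟨b, hb, rfl⟩
    exact ⟨(jB_mem_boundary_iff D i b).2 hb, b, rfl⟩

/-- **The handle pieces `incl⁻¹ (range jBᵢ) ≅ S³ ∖ S` of the seam are preconnected**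
(`isPathConnected_sphereOffCore`). [folklore] -/
theorem isPreconnected_preimage_range_jB (i : ι) : IsPreconnected (bX.incl ⁻¹' range (D.jB i)) := by
  rw [← bX.isSmoothEmbedding.isEmbedding.isInducing.isPreconnected_image,
    image_incl_preimage_range_jB D bX i]
  exact isPathConnected_sphereOffCore.isConnected.isPreconnected.image _
    (D.hjB i).1.isEmbedding.continuous.continuousOn

variable [IsManifold (𝓡∂ 4) ∞ B]

/-- `jA a ∈ ∂X ↔ a ∈ ∂B` (open smooth embeddings and open submanifolds preserve boundary points).
[cite: Kosinski1993, VI §6] -/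
theorem jA_mem_boundary_iff (a : ↥(coresComplement h)) :
    D.jA a ∈ (𝓡∂ 4).boundary X ↔ (a : B) ∈ (𝓡∂ 4).boundary B := by
  rw [mem_boundary_iff_of_isSmoothEmbedding D.hjA D.hjAo]
  exact mem_boundary_opens_iff (coresComplement h) a

/-- **The base piece of the seam**, read in `X`: `incl (incl⁻¹ (range jA)) = jA {a | a ∈ ∂B}`.
[cite: GompfStipsicz1999, §8.2] -/
theorem image_incl_preimage_range_jA :
    bX.incl '' (bX.incl ⁻¹' range D.jA) =
      D.jA '' ((Subtype.val : ↥(coresComplement h) → B) ⁻¹' (𝓡∂ 4).boundary B) := by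
  rw [image_preimage_eq_range_inter, bX.range_incl]
  ext p
  constructor
  · rintro ⟨hp, a, rfl⟩
    exact ⟨a, (jA_mem_boundary_iff D a).1 hp, rfl⟩
  · rintro ⟨a, ha, rfl⟩
    exact ⟨(jA_mem_boundary_iff D a).2 ha, a, rfl⟩

/-- **The base piece `incl⁻¹ (range jA) ≅ ∂B ∖ ⋃ Kᵢ` of the seam is preconnected** when `∂B` is
(§3, transported along the embeddings `incl`, `jA`, `Subtype.val`). [folklore] -/
theorem isPreconnected_preimage_range_jA (hB : IsPreconnected ((𝓡∂ 4).boundary B)) :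
    IsPreconnected (bX.incl ⁻¹' range D.jA) := by
  rw [← bX.isSmoothEmbedding.isEmbedding.isInducing.isPreconnected_image,
    image_incl_preimage_range_jA D bX]
  refine IsPreconnected.image ?_ _ D.hjA.isEmbedding.continuous.continuousOn
  have hset : (Subtype.val : ↥(coresComplement h) → B) ''
      ((Subtype.val : ↥(coresComplement h) → B) ⁻¹' (𝓡∂ 4).boundary B) =
      Subtype.val '' {p : ↥((𝓡∂ 4).boundary B) | (p : B) ∈ coresComplement h} := by
    ext q
    constructor
    · rintro ⟨a, ha, rfl⟩; exact ⟨⟨a, ha⟩, a.2, rfl⟩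
    · rintro ⟨p, hp, rfl⟩; exact ⟨⟨p, hp⟩, p.2, rfl⟩
  have key : IsPreconnected ((Subtype.val : ↥(coresComplement h) → B) ''
      ((Subtype.val : ↥(coresComplement h) → B) ⁻¹' (𝓡∂ 4).boundary B)) := by
    rw [hset]
    exact (isPreconnected_boundary_off_cores h D.disjoint hB).image _
      continuous_subtype_val.continuousOn
  exact Topology.IsInducing.subtypeVal.isPreconnected_image.1 key

/-- **The `i`-th handle piece meets the base piece of the seam**: at the glued Clifford point
`jA (h̄ᵢ c) = jBᵢ (α c)`, `c = (θ₀, θ₀)/√2 ∈ (T ∖ S) ∩ S³`. [cite: Kosinski1993, VI §6] -/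
theorem exists_mem_preimage_range_jA_jB (i : ι) :
    ∃ z, z ∈ bX.incl ⁻¹' range D.jA ∧ z ∈ bX.incl ⁻¹' range (D.jB i) := by
  set y : ↥(handleTube 3 2) := cliffordPt baseAngle baseAngle with hy
  have hlam : lamSq 2 (((y : closedBall (0 : EuclideanSpace ℝ (Fin 4)) 1) :
      EuclideanSpace ℝ (Fin 4))) ≠ 1 := by
    rw [hy]
    show lamSq 2 (cliffordVec baseAngle baseAngle) ≠ 1
    rw [lamSq_cliffordVec]; norm_num
  have hmem : (h i).toFun y ∈ coresComplement h := by
    rw [mem_coresComplement]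
    intro j hj
    by_cases hji : j = i
    · subst hji
      exact (glueRel_apply (h j) y hlam).not_mem_core hj
    · exact Set.disjoint_left.1 (D.disjoint hji) (image_subset_range _ _ hj) (mem_range_self y)
  set a : ↥(coresComplement h) := ⟨(h i).toFun y, hmem⟩ with ha
  have hglue : D.jA a = D.jB i ⟨_, (handleInversion_mem y.2 hlam).2.2⟩ :=
    (D.glue i a _).2 (glueRel_apply (h i) y hlam)
  have hbd : D.jA a ∈ range bX.incl := by
    rw [bX.range_incl, jA_mem_boundary_iff D a]
    exact (h i).isBoundaryPoint y (norm_cliffordVec baseAngle baseAngle)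
  obtain ⟨z, hz⟩ := hbd
  exact ⟨z, ⟨a, hz.symm⟩, ⟨_, (hz.trans hglue).symm⟩⟩

include D in
/-- **The seam of a multi-attachment of 2-handles on a 4-manifold with connected boundary is
connected**: `∂X = U ∪ ⋃ᵢ Wᵢ` with `U ≅ ∂B ∖ ⋃ Kᵢ` preconnected and nonempty, each `Wᵢ ≅ S³ ∖ S`
preconnected and meeting `U` (Gompf–Stipsicz 1999, §8.2: `∂X` is the surgery on `∂B` along the
framed attaching link). [cite: GompfStipsicz1999, §8.2] -/
theorem connectedSpace_carrier_of_multiAttachmentData (hB : IsConnected ((𝓡∂ 4).boundary B)) :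
    ConnectedSpace bX.carrier := by
  set U := bX.incl ⁻¹' range D.jA with hU
  set W := fun i => bX.incl ⁻¹' range (D.jB i) with hW
  have hUc : IsPreconnected U := isPreconnected_preimage_range_jA D bX hB.isPreconnected
  have hcov : U ∪ (⋃ i, W i) = univ := by
    rw [hU, hW, ← preimage_iUnion, ← preimage_union, D.cover, preimage_univ]
  -- a point of `U`
  obtain ⟨p, hp⟩ := nonempty_boundary_off_cores h D.disjoint hB.nonempty
  have hpa : D.jA ⟨(p : B), hp⟩ ∈ range bX.incl := by
    rw [bX.range_incl, jA_mem_boundary_iff D]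
    exact p.2
  obtain ⟨z₀, hz₀⟩ := hpa
  have hz₀U : z₀ ∈ U := ⟨_, hz₀.symm⟩
  have hpre : IsPreconnected (univ : Set bX.carrier) := by
    refine isPreconnected_of_forall z₀ fun z _ => ?_
    have hz : z ∈ U ∪ ⋃ i, W i := by rw [hcov]; exact mem_univ z
    rcases hz with hzU | hzW
    · exact ⟨U, subset_univ _, hz₀U, hzU, hUc⟩
    · obtain ⟨i, hzi⟩ := mem_iUnion.1 hzW
      obtain ⟨z₁, hz₁U, hz₁W⟩ := exists_mem_preimage_range_jA_jB D bX i
      exact ⟨U ∪ W i, subset_univ _, Or.inl hz₀U, Or.inr hzi,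
        hUc.union z₁ hz₁U hz₁W (isPreconnected_preimage_range_jB D bX i)⟩
  exact { isPreconnected_univ := hpre, toNonempty := ⟨z₀⟩ }

end Attachment

end BoundaryConnected

/-! ## §2 The exported forms and the registered sub-goal -/

/-- **CONNECTED, general form.**  For a 4-manifold `B` with connected boundary and any finite
simultaneous attachment `X` of 2-handles on `B` (Kosinski data `D`), every boundary datum of `X`
has connected carrier. [cite: GompfStipsicz1999, §8.2] -/
theorem connectedSpace_boundary_of_multiAttachmentData {B : Type*} [TopologicalSpace B] [T2Space B]
    [ChartedSpace (EuclideanHalfSpace 4) B] [IsManifold (𝓡∂ 4) ∞ B] {ι : Type*} [Finite ι]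
    {h : ι → HandleAttachingMap 3 2 B} {X : Type*} [TopologicalSpace X]
    [ChartedSpace (EuclideanHalfSpace 4) X] (D : MultiAttachmentData h (𝓡∂ 4) X)
    (hB : IsConnected ((𝓡∂ 4).boundary B)) (bX : BoundaryData (𝓡∂ 4) X (𝓡 3)) :
    ConnectedSpace bX.carrier :=
  BoundaryConnected.connectedSpace_carrier_of_multiAttachmentData D bX hB

/-- **CONNECTED, relational form** (`IsMultiAttachment`, the `∃`-form of the data): the boundary of
`X = B ∪ (2-handles)` is connected when `∂B` is. [cite: GompfStipsicz1999, §8.2] -/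
theorem connectedSpace_boundary_of_isMultiAttachment {B : Type*} [TopologicalSpace B] [T2Space B]
    [ChartedSpace (EuclideanHalfSpace 4) B] [IsManifold (𝓡∂ 4) ∞ B] {ι : Type*} [Finite ι]
    {h : ι → HandleAttachingMap 3 2 B} {X : Type*} [TopologicalSpace X]
    [ChartedSpace (EuclideanHalfSpace 4) X] (hX : IsMultiAttachment h (𝓡∂ 4) X)
    (hB : IsConnected ((𝓡∂ 4).boundary B)) (bX : BoundaryData (𝓡∂ 4) X (𝓡 3)) :
    ConnectedSpace bX.carrier :=
  connectedSpace_boundary_of_multiAttachmentData hX.multiAttachmentData hB bX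

/-- **CONNECTED for handles on the Lefschetz base** (T3 clause (v) for any family, e.g. the prefix
family of `stub_T3_dualPresentation`): the seam of a multi-attachment of 2-handles on `Base g` is
connected. [cite: GompfStipsicz1999, §8.2] -/
theorem connectedSpace_boundary_of_multiAttachmentData_base {g : ℕ} {ι : Type*} [Finite ι]
    {h : ι → HandleAttachingMap 3 2 (Base g)} {X : Type*} [TopologicalSpace X]
    [ChartedSpace (EuclideanHalfSpace 4) X] (D : MultiAttachmentData h (𝓡∂ 4) X)
    (bX : BoundaryData (𝓡∂ 4) X (𝓡 3)) : ConnectedSpace bX.carrier :=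
  connectedSpace_boundary_of_multiAttachmentData D (BoundaryConnected.isConnected_boundary_base g) bX

/-- **T3 clause (v), CONNECTED, in the assembler's telescope** (hypothesis `Hconn` of X2's
`T3_of_pieces`, text of `HconnStatement`, `work/stubs/X2_interfaces.lean` VERSION 1, verbatim): the
boundary `∂X₁` of the prefix piece of a Lefschetz handlebody is connected. [cite: GompfStipsicz1999, §8.2] -/
theorem T3_connected :
    ∀ (g : ℕ) (P N : List ((Fin g ⊕ Fin g → ℤ) × Bool))
      (h : Fin (P ++ N).length → HandleAttachingMap 3 2 (Base g)) (hlink : IsLefschetzLink g (P ++ N) h)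
      {X₁ : Type} [TopologicalSpace X₁] [T2Space X₁] [SecondCountableTopology X₁] [CompactSpace X₁]
      [ChartedSpace (EuclideanHalfSpace 4) X₁] [IsManifold (𝓡∂ 4) ∞ X₁]
      (D₁ : MultiAttachmentData
        (fun i : Fin P.length => h (Fin.cast List.length_append.symm (Fin.castAdd N.length i))) (𝓡∂ 4) X₁),
      ConnectedSpace (BoundaryManifold.boundaryData 3 X₁).carrier :=
  fun _ _ _ _ _ _ _ _ _ _ _ _ D₁ =>
    connectedSpace_boundary_of_multiAttachmentData_base D₁ (BoundaryManifold.boundaryData 3 _)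

/-- **Registered sub-goal `helper_T3_connected`** of `stub_T3_dualPresentation` (T3 clause (v),
CONNECTED; wave 5, lead c5): for every finite family of attaching maps of 2-handles on `Base g`,
every multi-attachment `X₁` along it and every boundary datum `b₁` of `X₁`, the carrier of `b₁` is
connected. [cite: GompfStipsicz1999, §8.2] -/
theorem helper_T3_connected : ∀ (g : ℕ) {ι : Type} [Finite ι] (h : ι → Literature.Topology.FourManifolds.HandleAttachingMap 3 2 (Literature.Topology.FourManifolds.LefschetzBase.Base g)) (X₁ : Type) [TopologicalSpace X₁] [ChartedSpace (EuclideanHalfSpace 4) X₁] (D₁ : Literature.Topology.FourManifolds.HandleAttachingMap.MultiAttachmentData h (𝓡∂ 4) X₁) (b₁ : Literature.Topology.FourManifolds.BoundaryData (𝓡∂ 4) X₁ (𝓡 3)), ConnectedSpace b₁.carrier :=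
  fun _ _ _ _ _ _ _ D₁ b₁ => connectedSpace_boundary_of_multiAttachmentData_base D₁ b₁

end Summit.SmoothPoincare4.SmoothPoincare4.Theorems.AcyclicBisectionExists.ModpBraidOrbits
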